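import Summits.AnomalousDissipation.AnomalousDissipation.Theorems.TaylorCertificatesTargetImpliesSteadyDirect
import Literature.Analysis.FluidPDE.StatisticalSolutionEnergyEq
import Literature.Analysis.FluidPDE.StatisticalSolutionProofs
import Literature.Analysis.FunctionSpaces.TorusSobolevSpaceProofs

/-!
# `TaylorCertificates.FloorCertificateEnsembleCeiling` (stmt-AnomalousDissipation-14086) — negative side III:
# ensemble weak duality with a budget, the pinch on every stationary statistics, the taxed species

Crux `X = FloorCertificateEnsembleCeiling` (route TaylorCertificates, rank-0 TARGET; FLOOR certificate + ensemble
CEILING for ONE force, see `Negative/SteadyPinch.lean`). This file (cdisprove seat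
`refuter-cdisprove-stmt-AnomalousDissipation-14086-g2-0`, 2026-08-16; crux work file `Cruxes/…/Disproof.lean` §C and
the line `Lines/Sketch.lean` of lead `prover-line-stmt-AnomalousDissipation-14086-0`; written WITHOUT auxiliary
definitions and importing only `TaylorCertificatesTargetImpliesSteadyDirect` + Literature, because the sibling
`Negative/` chains through `FloorCertificate/Negative/WeakDuality.lean` no longer build after route rev 13) proves:

* `budget_le_ensembleDissipation` — WEAK DUALITY WITH A STATE-DEPENDENT BUDGET over FMRT statistics: if
  `g(u) ≤ ν‖∇u‖² + ⟨F(u),Φ₁'(u)⟩ + 2θ₁((u,f) − ν‖∇u‖²)` at every finite-enstrophy state of the Leray ball and `θ₁ ≤ 0`,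
  then `∫ g dμ ≤ ε(μ)` for every stationary statistical solution `μ` of `NS_ν(f)` (FMRT IV Def. 1.3) integrating `g`
  (support ball (1.34), finite mean enstrophy (1.29), Liouville (1.30), mean energy inequality (1.31)–(1.33));
  `floor_le_ensembleDissipation` — the constant-budget case: X's FLOOR makes EVERY stationary statistics `ε₀`-loud.
* `ensemble_pinch`, `energy_window` — THE PINCH: under FLOOR ∧ CEILING at `(f, ε₀, E, ν)` every stationary
  statistical solution has `ε₀ ≤ ε(μ) ≤ ‖f‖₂ √e(μ) ≤ ‖f‖₂ √E` and `e(μ) ∈ [ε₀²/‖f‖₂², E]`: dissipation AND energy of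
  every invariant statistics of the witness force are pinned in ν-independent windows (no quiet, no lean, no fat
  statistics) — the exact shape a refutation must violate (`target_false_of_quietOrFatStatistics`, OPEN hypothesis).
* THE LINE'S SPECIES (taxed certificate `ε₁ + κ|u|² ≤ ν‖∇u‖² + ⟨F,Ψ'⟩ + 2α((u,f) − ν‖∇u‖²)`, `Lines/Sketch.lean`):
  `taxed_ensemble_pinch` — every stationary statistics is uniformly loud AND damped, `ε₁ + κ e(μ) ≤ ε(μ) ≤ ‖f‖₂√e(μ)`;
  `taxed_steady_pinch` / `taxedCertificate_constants` — NEW TIGHTNESS CONSTRAINT on the species: on a Leray–Temam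
  steady state `ε₁ + κ|u|² ≤ (u,f) ≤ |u|‖f‖₂`, hence `4 κ ε₁ ≤ ‖f‖₂²` for every taxed certificate at any `ν > 0`
  (the certified friction rate times the certified floor never exceeds a quarter of the force power; four times
  sharper than composing `ε₁² ≤ ‖f‖₂² E` with the line's ceiling `E = (‖f‖₂/κ)²`).
-/

noncomputable section

set_option linter.dupNamespace false

open MeasureTheory UnitAddTorus Filter Topology
open scoped InnerProductSpace ENNReal

namespace Summit.AnomalousDissipation.AnomalousDissipation.Theorems.FloorCertificateEnsembleCeiling.Negative

open Literature.Analysis.FunctionSpaces Literature.Analysis.FluidPDE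
open Summit.AnomalousDissipation.AnomalousDissipation.Theses.TaylorCertificates
open Summit.AnomalousDissipation.AnomalousDissipation.Theorems.TargetImpliesSteadyDirect

/-! ## Weak duality with a state-dependent budget over FMRT statistics -/

/-- **Weak duality with a state-dependent budget.** If `g(u) ≤ ν‖∇u‖² + ⟨F(u),Φ₁'(u)⟩ + 2θ₁((u,f) − ν‖∇u‖²)` at
every finite-enstrophy state of the Leray ball `|u|² ≤ 16‖f‖²/ν²`, `θ₁ ≤ 0`, `ν > 0`, `f ∈ L²`, then every
stationary statistical solution `μ` of `NS_ν(f)` under which `g` is integrable has `∫ g dμ ≤ ε(μ) = ν ∫‖∇u‖² dμ`.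
Proof: `μ` is carried by the support ball `|u| ≤ ‖f‖₂/(4π²ν)` ⊂ Leray ball (FMRT IV (1.34)) and has finite enstrophy
a.e. ((1.29)), so the budget floor holds `μ`-a.e.; integrate: the Liouville equation (1.30) kills the generator term
and `2θ₁(∫(u,f)dμ − ε(μ)) ≤ 0` by the mean energy inequality (1.31)–(1.33) and `θ₁ ≤ 0`. -/
theorem budget_le_ensembleDissipation {ν : ℝ} (hν : 0 < ν) {f : (UnitAddTorus (Fin 3) → EuclideanSpace ℝ (Fin 3))} (hf : MemLp f 2 volume)
    {Φ₁ : Torus.CylindricalTest (Fin 3)} {θ₁ : ℝ} (hθ₁ : θ₁ ≤ 0) {g : Torus.energySpace (Fin 3) → ℝ}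
    (hfloor : ∀ u : Torus.energySpace (Fin 3),
        Torus.eGradNormSq ((u : Lp (EuclideanSpace ℝ (Fin 3)) 2 (volume : Measure (UnitAddTorus (Fin 3)))) : UnitAddTorus (Fin 3) → EuclideanSpace ℝ (Fin 3)) ≠ ⊤ →
        ‖u‖ ^ 2 ≤ 16 * (∫ x, ‖f x‖ ^ 2) / ν ^ 2 →
        g u ≤ ν * (Torus.eGradNormSq ((u : Lp (EuclideanSpace ℝ (Fin 3)) 2 (volume : Measure (UnitAddTorus (Fin 3)))) : UnitAddTorus (Fin 3) → EuclideanSpace ℝ (Fin 3))).toReal + Torus.nsGeneratorPairing ν f u (Φ₁.grad u) +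
          2 * θ₁ * (Torus.pairing (u : Lp (EuclideanSpace ℝ (Fin 3)) 2 (volume : Measure (UnitAddTorus (Fin 3)))) f - ν * (Torus.eGradNormSq ((u : Lp (EuclideanSpace ℝ (Fin 3)) 2 (volume : Measure (UnitAddTorus (Fin 3)))) : UnitAddTorus (Fin 3) → EuclideanSpace ℝ (Fin 3))).toReal))
    {μ : Measure (Torus.energySpace (Fin 3))} (hμ : Torus.IsStationaryStatisticalSolution ν f μ) (hg : Integrable g μ) :
    ∫ u, g u ∂μ ≤ Torus.ensembleDissipation ν μ := by
  haveI := hμ.prob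
  set Gr : Torus.energySpace (Fin 3) → ℝ≥0∞ := fun u => Torus.eGradNormSq ((u : Lp (EuclideanSpace ℝ (Fin 3)) 2 (volume : Measure (UnitAddTorus (Fin 3)))) : UnitAddTorus (Fin 3) → EuclideanSpace ℝ (Fin 3)) with hGr
  have hGm : Measurable Gr := Torus.measurable_eGradNormSq_coe
  have hGfin : ∫⁻ u, Gr u ∂μ < ⊤ := hμ.enstrophy_finite
  have hGlt : ∀ᵐ u ∂μ, Gr u < ⊤ := ae_lt_top hGm hGfin.ne
  have hA : Integrable (fun u => (Gr u).toReal) μ := integrable_toReal_of_lintegral_ne_top hGm.aemeasurable hGfin.ne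
  have hball : ∀ᵐ u ∂μ, ‖u‖ ^ 2 ≤ 16 * (∫ x, ‖f x‖ ^ 2) / ν ^ 2 := by
    filter_upwards [hμ.ae_norm_le hν hf] with u hu
    exact leray_ball_of_norm_le hν hf hu
  -- the budget FLOOR holds `μ`-a.e.
  have hae : ∀ᵐ u ∂μ, g u ≤ ν * (Gr u).toReal + Torus.nsGeneratorPairing ν f u (Φ₁.grad u) +
      2 * θ₁ * (Torus.pairing (u : Lp (EuclideanSpace ℝ (Fin 3)) 2 (volume : Measure (UnitAddTorus (Fin 3)))) f - ν * (Gr u).toReal) := by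
    filter_upwards [hGlt, hball] with u hu hb
    exact hfloor u hu.ne hb
  obtain ⟨hC, hC0⟩ := hμ.generator Φ₁
  have hB : Integrable (fun u : Torus.energySpace (Fin 3) => Torus.pairing (u : Lp (EuclideanSpace ℝ (Fin 3)) 2 (volume : Measure (UnitAddTorus (Fin 3)))) f) μ := hμ.integrable_pairing hf
  have h1 : Integrable (fun u : Torus.energySpace (Fin 3) => ν * (Gr u).toReal) μ := hA.const_mul ν
  have h2 : Integrable (fun u : Torus.energySpace (Fin 3) => ν * (Gr u).toReal + Torus.nsGeneratorPairing ν f u (Φ₁.grad u)) μ := h1.add hC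
  have h3 : Integrable (fun u : Torus.energySpace (Fin 3) => Torus.pairing (u : Lp (EuclideanSpace ℝ (Fin 3)) 2 (volume : Measure (UnitAddTorus (Fin 3)))) f - ν * (Gr u).toReal) μ := hB.sub h1
  have h4 : Integrable (fun u : Torus.energySpace (Fin 3) => 2 * θ₁ * (Torus.pairing (u : Lp (EuclideanSpace ℝ (Fin 3)) 2 (volume : Measure (UnitAddTorus (Fin 3)))) f - ν * (Gr u).toReal)) μ := h3.const_mul _
  have hint : Integrable (fun u : Torus.energySpace (Fin 3) => ν * (Gr u).toReal + Torus.nsGeneratorPairing ν f u (Φ₁.grad u) +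
      2 * θ₁ * (Torus.pairing (u : Lp (EuclideanSpace ℝ (Fin 3)) 2 (volume : Measure (UnitAddTorus (Fin 3)))) f - ν * (Gr u).toReal)) μ := h2.add h4
  have hmono := integral_mono_ae hg hint hae
  have hsplit : ∫ u : Torus.energySpace (Fin 3), (ν * (Gr u).toReal + Torus.nsGeneratorPairing ν f u (Φ₁.grad u) +
      2 * θ₁ * (Torus.pairing (u : Lp (EuclideanSpace ℝ (Fin 3)) 2 (volume : Measure (UnitAddTorus (Fin 3)))) f - ν * (Gr u).toReal)) ∂μ =
      ν * (∫⁻ u, Gr u ∂μ).toReal + 0 +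
        2 * θ₁ * (∫ u : Torus.energySpace (Fin 3), Torus.pairing (u : Lp (EuclideanSpace ℝ (Fin 3)) 2 (volume : Measure (UnitAddTorus (Fin 3)))) f ∂μ - ν * (∫⁻ u, Gr u ∂μ).toReal) := by
    rw [integral_add h2 h4, integral_add h1 hC, integral_const_mul, integral_const_mul,
      integral_sub hB h1, integral_const_mul, hC0, integral_toReal hGm.aemeasurable hGlt]
  rw [hsplit] at hmono
  -- the mean energy inequality `ν ∫‖∇u‖² ≤ ∫ (u,f)` (FMRT IV (1.31)–(1.33))
  have hE : ν * (∫⁻ u, Gr u ∂μ).toReal ≤ ∫ u, Torus.pairing (u : Lp (EuclideanSpace ℝ (Fin 3)) 2 (volume : Measure (UnitAddTorus (Fin 3)))) f ∂μ :=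
    Torus.IsStationaryStatisticalSolution.energy_le_holds hμ hf
  have hθ : 2 * θ₁ * (∫ u, Torus.pairing (u : Lp (EuclideanSpace ℝ (Fin 3)) 2 (volume : Measure (UnitAddTorus (Fin 3)))) f ∂μ - ν * (∫⁻ u, Gr u ∂μ).toReal) ≤ 0 :=
    mul_nonpos_of_nonpos_of_nonneg (by linarith) (by linarith)
  change ∫ u, g u ∂μ ≤ ν * (∫⁻ u, Gr u ∂μ).toReal
  linarith

/-- **Weak duality for X's FLOOR (constant budget): every stationary statistics of the force is `ε₀`-loud.** -/
theorem floor_le_ensembleDissipation {ν : ℝ} (hν : 0 < ν) {f : (UnitAddTorus (Fin 3) → EuclideanSpace ℝ (Fin 3))} (hf : MemLp f 2 volume)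
    {Φ₁ : Torus.CylindricalTest (Fin 3)} {θ₁ ε₀ : ℝ} (hθ₁ : θ₁ ≤ 0)
    (hfloor : ∀ u : Torus.energySpace (Fin 3),
        Torus.eGradNormSq ((u : Lp (EuclideanSpace ℝ (Fin 3)) 2 (volume : Measure (UnitAddTorus (Fin 3)))) : UnitAddTorus (Fin 3) → EuclideanSpace ℝ (Fin 3)) ≠ ⊤ →
        ‖u‖ ^ 2 ≤ 16 * (∫ x, ‖f x‖ ^ 2) / ν ^ 2 →
        ε₀ ≤ ν * (Torus.eGradNormSq ((u : Lp (EuclideanSpace ℝ (Fin 3)) 2 (volume : Measure (UnitAddTorus (Fin 3)))) : UnitAddTorus (Fin 3) → EuclideanSpace ℝ (Fin 3))).toReal + Torus.nsGeneratorPairing ν f u (Φ₁.grad u) +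
          2 * θ₁ * (Torus.pairing (u : Lp (EuclideanSpace ℝ (Fin 3)) 2 (volume : Measure (UnitAddTorus (Fin 3)))) f - ν * (Torus.eGradNormSq ((u : Lp (EuclideanSpace ℝ (Fin 3)) 2 (volume : Measure (UnitAddTorus (Fin 3)))) : UnitAddTorus (Fin 3) → EuclideanSpace ℝ (Fin 3))).toReal))
    {μ : Measure (Torus.energySpace (Fin 3))} (hμ : Torus.IsStationaryStatisticalSolution ν f μ) :
    ε₀ ≤ Torus.ensembleDissipation ν μ := by
  haveI := hμ.prob
  have h := budget_le_ensembleDissipation hν hf hθ₁ (g := fun _ => ε₀) hfloor hμ (integrable_const ε₀)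
  simpa using h

/-! ## The pinch on every stationary statistics -/

/-- **The pinch.** Under FLOOR ∧ CEILING at `(f, ε₀, E, ν)` (`ν > 0`, `f ∈ L²`), EVERY stationary statistical
solution `μ` of `NS_ν(f)` has dissipation `ε(μ) ≥ ε₀` (weak duality), energy `e(μ) ≤ E` (the ceiling; the energy is
automatically integrable, (1.29) + Poincaré) and `ε(μ) ≤ ‖f‖₂ √e(μ) ≤ ‖f‖₂ √E` (mean energy inequality +
Cauchy–Schwarz, `ensembleDissipation_le_of_isStationary_holds`): both the dissipation and the energy of every
invariant statistics of the witness force live in ν-INDEPENDENT windows. -/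
theorem ensemble_pinch {ν : ℝ} (hν : 0 < ν) {f : (UnitAddTorus (Fin 3) → EuclideanSpace ℝ (Fin 3))} (hf : MemLp f 2 volume) {ε₀ E : ℝ}
    (hpair : (∃ (Φ₁ : Torus.CylindricalTest (Fin 3)) (θ₁ : ℝ), θ₁ ≤ 0 ∧ ∀ u : Torus.energySpace (Fin 3),
        Torus.eGradNormSq ((u : Lp (EuclideanSpace ℝ (Fin 3)) 2 (volume : Measure (UnitAddTorus (Fin 3)))) : UnitAddTorus (Fin 3) → EuclideanSpace ℝ (Fin 3)) ≠ ⊤ →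
        ‖u‖ ^ 2 ≤ 16 * (∫ x, ‖f x‖ ^ 2) / ν ^ 2 →
        ε₀ ≤ ν * (Torus.eGradNormSq ((u : Lp (EuclideanSpace ℝ (Fin 3)) 2 (volume : Measure (UnitAddTorus (Fin 3)))) : UnitAddTorus (Fin 3) → EuclideanSpace ℝ (Fin 3))).toReal + Torus.nsGeneratorPairing ν f u (Φ₁.grad u) +
          2 * θ₁ * (Torus.pairing (u : Lp (EuclideanSpace ℝ (Fin 3)) 2 (volume : Measure (UnitAddTorus (Fin 3)))) f - ν * (Torus.eGradNormSq ((u : Lp (EuclideanSpace ℝ (Fin 3)) 2 (volume : Measure (UnitAddTorus (Fin 3)))) : UnitAddTorus (Fin 3) → EuclideanSpace ℝ (Fin 3))).toReal)) ∧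
      (∀ μ : Measure (Torus.energySpace (Fin 3)), Torus.IsStationaryStatisticalSolution ν f μ →
        Integrable (fun v : Torus.energySpace (Fin 3) => ‖v‖ ^ 2) μ → Torus.ensembleEnergy μ ≤ E))
    {μ : Measure (Torus.energySpace (Fin 3))} (hμ : Torus.IsStationaryStatisticalSolution ν f μ) :
    ε₀ ≤ Torus.ensembleDissipation ν μ ∧ Torus.ensembleEnergy μ ≤ E ∧
      Torus.ensembleDissipation ν μ ≤ Real.sqrt (∫ x, ‖f x‖ ^ 2) * Real.sqrt (Torus.ensembleEnergy μ) ∧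
      Torus.ensembleDissipation ν μ ≤ Real.sqrt (∫ x, ‖f x‖ ^ 2) * Real.sqrt E := by
  obtain ⟨⟨Φ₁, θ₁, hθ₁, hfloor⟩, hceil⟩ := hpair
  have hint : Integrable (fun v : Torus.energySpace (Fin 3) => ‖v‖ ^ 2) μ := hμ.integrable_norm_sq
  have h1 : ε₀ ≤ Torus.ensembleDissipation ν μ := floor_le_ensembleDissipation hν hf hθ₁ hfloor hμ
  have h2 : Torus.ensembleEnergy μ ≤ E := hceil μ hμ hint
  have h3 : Torus.ensembleDissipation ν μ ≤ Real.sqrt (∫ x, ‖f x‖ ^ 2) * Real.sqrt (Torus.ensembleEnergy μ) :=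
    Torus.ensembleDissipation_le_of_isStationary_holds hμ hf hint
  refine ⟨h1, h2, h3, h3.trans ?_⟩
  exact mul_le_mul_of_nonneg_left (Real.sqrt_le_sqrt h2) (Real.sqrt_nonneg _)

/-- **Energy window from below (no lean statistics under the pair).** Under FLOOR ∧ CEILING with `ε₀ ≥ 0`, every
stationary statistical solution has `ε₀² ≤ ‖f‖₂² · e(μ)` and `e(μ) ≤ E`. -/
theorem energy_window {ν : ℝ} (hν : 0 < ν) {f : (UnitAddTorus (Fin 3) → EuclideanSpace ℝ (Fin 3))} (hf : MemLp f 2 volume) {ε₀ E : ℝ} (hε₀ : 0 ≤ ε₀)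
    (hpair : (∃ (Φ₁ : Torus.CylindricalTest (Fin 3)) (θ₁ : ℝ), θ₁ ≤ 0 ∧ ∀ u : Torus.energySpace (Fin 3),
        Torus.eGradNormSq ((u : Lp (EuclideanSpace ℝ (Fin 3)) 2 (volume : Measure (UnitAddTorus (Fin 3)))) : UnitAddTorus (Fin 3) → EuclideanSpace ℝ (Fin 3)) ≠ ⊤ →
        ‖u‖ ^ 2 ≤ 16 * (∫ x, ‖f x‖ ^ 2) / ν ^ 2 →
        ε₀ ≤ ν * (Torus.eGradNormSq ((u : Lp (EuclideanSpace ℝ (Fin 3)) 2 (volume : Measure (UnitAddTorus (Fin 3)))) : UnitAddTorus (Fin 3) → EuclideanSpace ℝ (Fin 3))).toReal + Torus.nsGeneratorPairing ν f u (Φ₁.grad u) +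
          2 * θ₁ * (Torus.pairing (u : Lp (EuclideanSpace ℝ (Fin 3)) 2 (volume : Measure (UnitAddTorus (Fin 3)))) f - ν * (Torus.eGradNormSq ((u : Lp (EuclideanSpace ℝ (Fin 3)) 2 (volume : Measure (UnitAddTorus (Fin 3)))) : UnitAddTorus (Fin 3) → EuclideanSpace ℝ (Fin 3))).toReal)) ∧
      (∀ μ : Measure (Torus.energySpace (Fin 3)), Torus.IsStationaryStatisticalSolution ν f μ →
        Integrable (fun v : Torus.energySpace (Fin 3) => ‖v‖ ^ 2) μ → Torus.ensembleEnergy μ ≤ E))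
    {μ : Measure (Torus.energySpace (Fin 3))} (hμ : Torus.IsStationaryStatisticalSolution ν f μ) :
    ε₀ ^ 2 ≤ (∫ x, ‖f x‖ ^ 2) * Torus.ensembleEnergy μ ∧ Torus.ensembleEnergy μ ≤ E := by
  obtain ⟨h1, h2, h3, -⟩ := ensemble_pinch hν hf hpair hμ
  haveI := hμ.prob
  have hF : 0 ≤ ∫ x, ‖f x‖ ^ 2 := integral_nonneg fun x => by positivity
  have he : 0 ≤ Torus.ensembleEnergy μ := integral_nonneg fun u => by positivity
  refine ⟨?_, h2⟩
  have h4 : ε₀ ≤ Real.sqrt (∫ x, ‖f x‖ ^ 2) * Real.sqrt (Torus.ensembleEnergy μ) := h1.trans h3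
  have h5 : ε₀ ^ 2 ≤ (Real.sqrt (∫ x, ‖f x‖ ^ 2) * Real.sqrt (Torus.ensembleEnergy μ)) ^ 2 :=
    pow_le_pow_left₀ hε₀ h4 2
  rwa [mul_pow, Real.sq_sqrt hF, Real.sq_sqrt he] at h5

/-- **Negative lemma modulo the ensemble adversary** (weak duality; NOT a refutation — the hypothesis is the open
ensemble zeroth-law-with-saturation question for every force): IF every admissible `f ≠ 0` admits, for every box
`(ε₀, E)` and at arbitrarily small `ν`, a stationary statistical solution of `NS_ν(f)` that is QUIET (`ε(μ) < ε₀`) or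
FAT (`e(μ) > E`), then `X` is false. Strictly weaker than "quiet statistics for every force" and than "fat statistics
for every force": the adversary may change sides with `f` (planar forces quiet, Euler-steady single-shell forces fat). -/
theorem target_false_of_quietOrFatStatistics
    (hQ : ∀ f : (UnitAddTorus (Fin 3) → EuclideanSpace ℝ (Fin 3)), Torus.IsSmooth f → Torus.IsDivFree f → Torus.HasZeroMean f →
      0 < (∫ x, ‖f x‖ ^ 2) → ∀ ε₀ E ν₀ : ℝ, 0 < ε₀ → 0 < ν₀ → ∃ ν : ℝ, 0 < ν ∧ ν < ν₀ ∧
        ∃ μ : Measure (Torus.energySpace (Fin 3)), Torus.IsStationaryStatisticalSolution ν f μ ∧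
          (Torus.ensembleDissipation ν μ < ε₀ ∨ E < Torus.ensembleEnergy μ)) :
    ¬ FloorCertificateEnsembleCeiling := by
  rintro ⟨f, hfs, hfd, hfz, ε₀, E, ν₀, hε₀, hν₀, h⟩
  have hf2 : MemLp f 2 volume := hfs.memLp 2
  -- `f ≠ 0`: at `ν₀/2` the pinch on a Leray–Temam steady state gives `0 < ε₀ ≤ (u,f) ≤ |u|‖f‖₂`
  have hF : 0 < ∫ x, ‖f x‖ ^ 2 := by
    obtain ⟨⟨Φ₁, θ₁, -, hfloor⟩, -⟩ := h (ν₀ / 2) (half_pos hν₀) (by linarith)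
    obtain ⟨u, hV, hu⟩ := Torus.Temam1979_exists_steadyWeakSolution_holds (by simp) (half_pos hν₀) hf2
    have h1 := floor_le_dissipation_of_steady (half_pos hν₀) hf2 hfloor hV hu
    have h2 : ν₀ / 2 * (Torus.eGradNormSq ((u : Lp (EuclideanSpace ℝ (Fin 3)) 2 (volume : Measure (UnitAddTorus (Fin 3)))) : UnitAddTorus (Fin 3) → EuclideanSpace ℝ (Fin 3))).toReal = Torus.pairing (u : Lp (EuclideanSpace ℝ (Fin 3)) 2 (volume : Measure (UnitAddTorus (Fin 3)))) f :=
      Torus.IsSteadyWeakSolution.energy_eq' (by simp) hf2 hV hu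
    have h3 : Torus.pairing (u : Lp (EuclideanSpace ℝ (Fin 3)) 2 (volume : Measure (UnitAddTorus (Fin 3)))) f ≤ ‖u‖ * ‖hf2.toLp f‖ :=
      (le_abs_self _).trans (Torus.abs_pairing_coe_le hf2 u)
    have h4 : 0 < ‖hf2.toLp f‖ := by
      by_contra h0
      have h0' : ‖hf2.toLp f‖ = 0 := le_antisymm (not_lt.1 h0) (norm_nonneg _)
      rw [h0', mul_zero] at h3
      linarith
    have h5 : ‖hf2.toLp f‖ ^ 2 = ∫ x, ‖f x‖ ^ 2 := by
      rw [Torus.norm_toLp_eq_sqrt hf2, Real.sq_sqrt (integral_nonneg fun x => by positivity)]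
    nlinarith
  obtain ⟨ν, hν, hνν₀, μ, hμ, hq⟩ := hQ f hfs hfd hfz hF ε₀ E ν₀ hε₀ hν₀
  obtain ⟨h1, h2, -, -⟩ := ensemble_pinch hν hf2 (h ν hν hνν₀) hμ
  rcases hq with hq | hq <;> linarith

/-! ## The line's species: the taxed certificate pins and damps every statistics; `4κε₁ ≤ ‖f‖₂²` -/

/-- **The taxed pinch on statistics.** Under an energy-TAXED floor `ε₁ + κ|u|² ≤ ν‖∇u‖² + ⟨F(u),Φ₁'(u)⟩ +
2θ₁((u,f) − ν‖∇u‖²)` on the finite-enstrophy Leray ball (`θ₁ ≤ 0`, `ν > 0`, `f ∈ L²`), every stationary statistical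
solution of `NS_ν(f)` is uniformly LOUD and uniformly DAMPED: `ε₁ + κ e(μ) ≤ ε(μ) ≤ ‖f‖₂ √e(μ)`. (With `κ > 0` this
caps `e(μ) ≤ (‖f‖₂/κ)²` — the line's `stub_ceilingOfTaxed` — and with `ε₁ > 0` it floors `ε(μ)`.) -/
theorem taxed_ensemble_pinch {ν : ℝ} (hν : 0 < ν) {f : (UnitAddTorus (Fin 3) → EuclideanSpace ℝ (Fin 3))} (hf : MemLp f 2 volume)
    {Φ₁ : Torus.CylindricalTest (Fin 3)} {θ₁ ε₁ κ : ℝ} (hθ₁ : θ₁ ≤ 0)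
    (hfloor : ∀ u : Torus.energySpace (Fin 3),
        Torus.eGradNormSq ((u : Lp (EuclideanSpace ℝ (Fin 3)) 2 (volume : Measure (UnitAddTorus (Fin 3)))) : UnitAddTorus (Fin 3) → EuclideanSpace ℝ (Fin 3)) ≠ ⊤ →
        ‖u‖ ^ 2 ≤ 16 * (∫ x, ‖f x‖ ^ 2) / ν ^ 2 →
        ε₁ + κ * ‖u‖ ^ 2 ≤ ν * (Torus.eGradNormSq ((u : Lp (EuclideanSpace ℝ (Fin 3)) 2 (volume : Measure (UnitAddTorus (Fin 3)))) : UnitAddTorus (Fin 3) → EuclideanSpace ℝ (Fin 3))).toReal + Torus.nsGeneratorPairing ν f u (Φ₁.grad u) +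
          2 * θ₁ * (Torus.pairing (u : Lp (EuclideanSpace ℝ (Fin 3)) 2 (volume : Measure (UnitAddTorus (Fin 3)))) f - ν * (Torus.eGradNormSq ((u : Lp (EuclideanSpace ℝ (Fin 3)) 2 (volume : Measure (UnitAddTorus (Fin 3)))) : UnitAddTorus (Fin 3) → EuclideanSpace ℝ (Fin 3))).toReal))
    {μ : Measure (Torus.energySpace (Fin 3))} (hμ : Torus.IsStationaryStatisticalSolution ν f μ) :
    ε₁ + κ * Torus.ensembleEnergy μ ≤ Torus.ensembleDissipation ν μ ∧
      Torus.ensembleDissipation ν μ ≤ Real.sqrt (∫ x, ‖f x‖ ^ 2) * Real.sqrt (Torus.ensembleEnergy μ) := by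
  haveI := hμ.prob
  have hint : Integrable (fun v : Torus.energySpace (Fin 3) => ‖v‖ ^ 2) μ := hμ.integrable_norm_sq
  have hg : Integrable (fun u : Torus.energySpace (Fin 3) => ε₁ + κ * ‖u‖ ^ 2) μ := (integrable_const ε₁).add (hint.const_mul κ)
  have hA := budget_le_ensembleDissipation hν hf hθ₁ (g := fun u : Torus.energySpace (Fin 3) => ε₁ + κ * ‖u‖ ^ 2) hfloor hμ hg
  have hsplit : ∫ u : Torus.energySpace (Fin 3), (ε₁ + κ * ‖u‖ ^ 2) ∂μ = ε₁ + κ * Torus.ensembleEnergy μ := by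
    rw [integral_add (integrable_const ε₁) (hint.const_mul κ), integral_const_mul]
    simp [Torus.ensembleEnergy]
  rw [hsplit] at hA
  exact ⟨hA, Torus.ensembleDissipation_le_of_isStationary_holds hμ hf hint⟩

/-- **The taxed pinch on atoms.** Under a taxed floor at `(f, ν)` (any `θ₁`; `ν > 0`, `f ∈ L²`) every steady weak
solution `u ∈ V` of `NS_ν(f)` satisfies `ε₁ + κ|u|² ≤ ν‖∇u‖² = (u, f) ≤ |u| ‖f‖₂` (the generator term and the
energy channel vanish at a steady state; = the line's `stub_steadyTaxed`, re-proved over a building import chain). -/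
theorem taxed_steady_pinch {ν : ℝ} (hν : 0 < ν) {f : (UnitAddTorus (Fin 3) → EuclideanSpace ℝ (Fin 3))} (hf : MemLp f 2 volume)
    {Φ₁ : Torus.CylindricalTest (Fin 3)} {θ₁ ε₁ κ : ℝ}
    (hfloor : ∀ u : Torus.energySpace (Fin 3),
        Torus.eGradNormSq ((u : Lp (EuclideanSpace ℝ (Fin 3)) 2 (volume : Measure (UnitAddTorus (Fin 3)))) : UnitAddTorus (Fin 3) → EuclideanSpace ℝ (Fin 3)) ≠ ⊤ →
        ‖u‖ ^ 2 ≤ 16 * (∫ x, ‖f x‖ ^ 2) / ν ^ 2 →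
        ε₁ + κ * ‖u‖ ^ 2 ≤ ν * (Torus.eGradNormSq ((u : Lp (EuclideanSpace ℝ (Fin 3)) 2 (volume : Measure (UnitAddTorus (Fin 3)))) : UnitAddTorus (Fin 3) → EuclideanSpace ℝ (Fin 3))).toReal + Torus.nsGeneratorPairing ν f u (Φ₁.grad u) +
          2 * θ₁ * (Torus.pairing (u : Lp (EuclideanSpace ℝ (Fin 3)) 2 (volume : Measure (UnitAddTorus (Fin 3)))) f - ν * (Torus.eGradNormSq ((u : Lp (EuclideanSpace ℝ (Fin 3)) 2 (volume : Measure (UnitAddTorus (Fin 3)))) : UnitAddTorus (Fin 3) → EuclideanSpace ℝ (Fin 3))).toReal))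
    {u : Torus.energySpace (Fin 3)} (hV : (u : Lp (EuclideanSpace ℝ (Fin 3)) 2 (volume : Measure (UnitAddTorus (Fin 3)))) ∈ Torus.energySpaceV (Fin 3)) (hu : Torus.IsSteadyWeakSolution ν f u) :
    ε₁ + κ * ‖u‖ ^ 2 ≤ ν * (Torus.eGradNormSq ((u : Lp (EuclideanSpace ℝ (Fin 3)) 2 (volume : Measure (UnitAddTorus (Fin 3)))) : UnitAddTorus (Fin 3) → EuclideanSpace ℝ (Fin 3))).toReal ∧
      ν * (Torus.eGradNormSq ((u : Lp (EuclideanSpace ℝ (Fin 3)) 2 (volume : Measure (UnitAddTorus (Fin 3)))) : UnitAddTorus (Fin 3) → EuclideanSpace ℝ (Fin 3))).toReal = Torus.pairing (u : Lp (EuclideanSpace ℝ (Fin 3)) 2 (volume : Measure (UnitAddTorus (Fin 3)))) f ∧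
      Torus.pairing (u : Lp (EuclideanSpace ℝ (Fin 3)) 2 (volume : Measure (UnitAddTorus (Fin 3)))) f ≤ ‖u‖ * ‖hf.toLp f‖ := by
  have hfin : Torus.eGradNormSq ((u : Lp (EuclideanSpace ℝ (Fin 3)) 2 (volume : Measure (UnitAddTorus (Fin 3)))) : UnitAddTorus (Fin 3) → EuclideanSpace ℝ (Fin 3)) ≠ ⊤ := hV.2.eGradNormSq_lt_top.ne
  have henergy : ν * (Torus.eGradNormSq ((u : Lp (EuclideanSpace ℝ (Fin 3)) 2 (volume : Measure (UnitAddTorus (Fin 3)))) : UnitAddTorus (Fin 3) → EuclideanSpace ℝ (Fin 3))).toReal = Torus.pairing (u : Lp (EuclideanSpace ℝ (Fin 3)) 2 (volume : Measure (UnitAddTorus (Fin 3)))) f :=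
    Torus.IsSteadyWeakSolution.energy_eq' (by simp) hf hV hu
  have hgen : Torus.nsGeneratorPairing ν f u (Φ₁.grad u) = 0 :=
    hu _ (Torus.CylindricalTest.isSmooth_grad_holds Φ₁ u) (Torus.CylindricalTest.isDivFree_grad_holds Φ₁ u)
      (Torus.CylindricalTest.hasZeroMean_grad_holds Φ₁ u)
  have hp : Torus.pairing (u : Lp (EuclideanSpace ℝ (Fin 3)) 2 (volume : Measure (UnitAddTorus (Fin 3)))) f ≤ ‖u‖ * ‖hf.toLp f‖ :=
    (le_abs_self _).trans (Torus.abs_pairing_coe_le hf u)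
  have hball : ‖u‖ ^ 2 ≤ 16 * (∫ x, ‖f x‖ ^ 2) / ν ^ 2 := by
    refine leray_ball_of_norm_le hν hf ?_
    have hP := Torus.norm_sq_le_toReal_eGradNormSq u hfin
    rw [le_div_iff₀ (by positivity)]
    by_cases h0 : ‖u‖ = 0
    · rw [h0, zero_mul]; exact norm_nonneg _
    · have hpos : 0 < ‖u‖ := lt_of_le_of_ne (norm_nonneg _) (Ne.symm h0)
      have : ν * (4 * Real.pi ^ 2 * ‖u‖ ^ 2) ≤ ‖u‖ * ‖hf.toLp f‖ := by nlinarith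
      nlinarith
  have h := hfloor u hfin hball
  rw [hgen, ← henergy] at h
  refine ⟨by linarith, henergy, hp⟩

/-- **TIGHTNESS CONSTRAINT ON THE LINE'S SPECIES: `4 κ ε₁ ≤ ‖f‖₂²`.** If a taxed floor with constants `(ε₁, κ)`,
`κ ≥ 0`, holds on the finite-enstrophy Leray ball of `(f, ν)` for some `ν > 0` (any multiplier `(Φ₁, θ₁)`, no sign
condition), then `4 κ ε₁ ≤ ‖f‖₂²`: the Leray–Temam steady state `u` (exists at every `ν`) gives
`ε₁ + κ|u|² ≤ (u,f) ≤ |u|‖f‖₂`, and `|u|‖f‖₂ − κ|u|² ≤ ‖f‖₂²/(4κ)`. So along the line `Sketch` the certified friction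
rate and the certified floor trade off against each other at fixed force power — four times sharper than composing
`ε₁² ≤ ‖f‖₂² E` (`Negative/SteadyPinch.pair_constants`) with the line's ceiling `E = (‖f‖₂/κ)²`. -/
theorem taxedCertificate_constants {ν : ℝ} (hν : 0 < ν) {f : (UnitAddTorus (Fin 3) → EuclideanSpace ℝ (Fin 3))} (hf : MemLp f 2 volume)
    {Φ₁ : Torus.CylindricalTest (Fin 3)} {θ₁ ε₁ κ : ℝ} (hκ : 0 ≤ κ)
    (hfloor : ∀ u : Torus.energySpace (Fin 3),
        Torus.eGradNormSq ((u : Lp (EuclideanSpace ℝ (Fin 3)) 2 (volume : Measure (UnitAddTorus (Fin 3)))) : UnitAddTorus (Fin 3) → EuclideanSpace ℝ (Fin 3)) ≠ ⊤ →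
        ‖u‖ ^ 2 ≤ 16 * (∫ x, ‖f x‖ ^ 2) / ν ^ 2 →
        ε₁ + κ * ‖u‖ ^ 2 ≤ ν * (Torus.eGradNormSq ((u : Lp (EuclideanSpace ℝ (Fin 3)) 2 (volume : Measure (UnitAddTorus (Fin 3)))) : UnitAddTorus (Fin 3) → EuclideanSpace ℝ (Fin 3))).toReal + Torus.nsGeneratorPairing ν f u (Φ₁.grad u) +
          2 * θ₁ * (Torus.pairing (u : Lp (EuclideanSpace ℝ (Fin 3)) 2 (volume : Measure (UnitAddTorus (Fin 3)))) f - ν * (Torus.eGradNormSq ((u : Lp (EuclideanSpace ℝ (Fin 3)) 2 (volume : Measure (UnitAddTorus (Fin 3)))) : UnitAddTorus (Fin 3) → EuclideanSpace ℝ (Fin 3))).toReal)) :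
    4 * κ * ε₁ ≤ ∫ x, ‖f x‖ ^ 2 := by
  obtain ⟨u, hV, hu⟩ := Torus.Temam1979_exists_steadyWeakSolution_holds (by simp) hν hf
  obtain ⟨h1, h2, h3⟩ := taxed_steady_pinch hν hf hfloor hV hu
  have hF : ‖hf.toLp f‖ ^ 2 = ∫ x, ‖f x‖ ^ 2 := by
    rw [Torus.norm_toLp_eq_sqrt hf, Real.sq_sqrt (integral_nonneg fun x => by positivity)]
  have h : ε₁ + κ * ‖u‖ ^ 2 ≤ ‖u‖ * ‖hf.toLp f‖ := by linarith
  have h4 : κ * (ε₁ + κ * ‖u‖ ^ 2) ≤ κ * (‖u‖ * ‖hf.toLp f‖) := mul_le_mul_of_nonneg_left h hκ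
  rw [← hF]
  nlinarith [sq_nonneg (‖hf.toLp f‖ - 2 * κ * ‖u‖)]

/-- The same constraint read on the line's certificate species `TaxedCertificate` (`Lines/Sketch.lean`, expanded):
any witness `(f, ε₁, κ, ν₀)` has `4 κ ε₁ ≤ ‖f‖₂²`. -/
theorem taxedCertificate_constants' {f : (UnitAddTorus (Fin 3) → EuclideanSpace ℝ (Fin 3))} (hfs : Torus.IsSmooth f) {ε₁ κ ν₀ : ℝ} (hκ : 0 ≤ κ)
    (hν₀ : 0 < ν₀)
    (hcert : ∀ ν : ℝ, 0 < ν → ν < ν₀ → ∃ (Φ₁ : Torus.CylindricalTest (Fin 3)) (θ₁ : ℝ), θ₁ ≤ 0 ∧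
        ∀ u : Torus.energySpace (Fin 3),
          Torus.eGradNormSq ((u : Lp (EuclideanSpace ℝ (Fin 3)) 2 (volume : Measure (UnitAddTorus (Fin 3)))) : UnitAddTorus (Fin 3) → EuclideanSpace ℝ (Fin 3)) ≠ ⊤ →
          ‖u‖ ^ 2 ≤ 16 * (∫ x, ‖f x‖ ^ 2) / ν ^ 2 →
          ε₁ + κ * ‖u‖ ^ 2 ≤ ν * (Torus.eGradNormSq ((u : Lp (EuclideanSpace ℝ (Fin 3)) 2 (volume : Measure (UnitAddTorus (Fin 3)))) : UnitAddTorus (Fin 3) → EuclideanSpace ℝ (Fin 3))).toReal + Torus.nsGeneratorPairing ν f u (Φ₁.grad u) +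
            2 * θ₁ * (Torus.pairing (u : Lp (EuclideanSpace ℝ (Fin 3)) 2 (volume : Measure (UnitAddTorus (Fin 3)))) f - ν * (Torus.eGradNormSq ((u : Lp (EuclideanSpace ℝ (Fin 3)) 2 (volume : Measure (UnitAddTorus (Fin 3)))) : UnitAddTorus (Fin 3) → EuclideanSpace ℝ (Fin 3))).toReal)) :
    4 * κ * ε₁ ≤ ∫ x, ‖f x‖ ^ 2 := by
  obtain ⟨Φ₁, θ₁, -, hfloor⟩ := hcert (ν₀ / 2) (half_pos hν₀) (by linarith)
  exact taxedCertificate_constants (half_pos hν₀) (hfs.memLp 2) hκ hfloor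

end Summit.AnomalousDissipation.AnomalousDissipation.Theorems.FloorCertificateEnsembleCeiling.Negative

end
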